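import Literature.Probability.LatticeModels.FatRectanglePoincareStep
import HarnessLib

/-!
# The scale step of [Mar99] Theorem 4.5 with the printed rate `1 − k/√L`, PROVED

Topic `Literature/Probability/LatticeModels`; cell `ym-ir`, seat lit-3 (census rows B2/B4).  Theorems only
(D-0026).  [Mar99] Theorem 4.5, proof, (4.16)–(4.19) p0189–p0190: with `d = ⌊√L⌋` and `≈ L/(10d)` overlap
strips the loss per halving is `1 − C₁/√L`.  Here the parameters of `Glauber.fatRectangles_poincare_step` are
instantiated as `δ = ⌊√L'⌋`, `ρ = δ − r`, `N + 1 = ⌊L'/(12δ)⌋`, the two-block error `κ(L')` is shown to be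
`≤ 1/(4L')` for `L'` large (it is `O(L'^6 e^{−m√L'})`), and the factor `θ²` is bounded below by
`1 − 100/√L'`: `Glauber.fatRectangles_poincare_step_rate`.  Iterating three times (`L → 4L/3 → 16L/9 → 64L/27
⊇ 2L`) gives the FIRST conjunct of the typed fact `Glauber.Martinelli1999_thm4_5` with `k = 300`
(`Glauber.fatRectangles_poincare_doubling`).  SIBLING-SETTING result (`±1` spins, range `r`); the Yang–Mills gap
is not touched. [cite: Martinelli1999, Theorem 4.5, proof, (4.16)–(4.19)]
-/

open MeasureTheory ProbabilityTheory Finset Filter Topology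

noncomputable section

namespace Literature.Probability.LatticeModels

namespace Glauber

variable {r : ℕ} (U : FRPotential 2 ℤˣ r) (β : ℝ)

/-- Polynomial times decaying exponential tends to zero along the naturals. [folklore] -/
private theorem tendsto_const_mul_pow_mul_exp_neg₃ {a : ℝ} (ha : 0 < a) (n : ℕ) (K : ℝ) :
    Tendsto (fun l : ℕ => K * ((l : ℝ) ^ n * Real.exp (-(a * (l : ℝ))))) atTop (𝓝 0) := by
  have hx : Tendsto (fun l : ℕ => a * (l : ℝ)) atTop atTop :=
    Tendsto.const_mul_atTop ha tendsto_natCast_atTop_atTop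
  have h0 := (Real.tendsto_pow_mul_exp_neg_atTop_nhds_zero n).comp hx
  have heq : (fun l : ℕ => K * ((l : ℝ) ^ n * Real.exp (-(a * (l : ℝ))))) =
      fun l : ℕ => (K * (1 / a) ^ n) * ((a * (l : ℝ)) ^ n * Real.exp (-(a * (l : ℝ)))) := by
    funext l
    rw [mul_pow, one_div, inv_pow]
    field_simp
  rw [heq]
  simpa using tendsto_const_nhds.mul h0

set_option maxHeartbeats 4000000 in
/-- **[Mar99] Theorem 4.5, the scale step with rate `1 − 100/√L'`**: there is `L₁` such that for `L' ≥ L₁`,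
gap `≥ g ≥ 0` on `𝓡_{L'}` (all boundary conditions) implies gap `≥ (1 − 100/√L') g` on `𝓡_{L''}` whenever
`3L'' ≤ 4L'`. [cite: Martinelli1999, Theorem 4.5, proof, (4.16)–(4.19)] -/
theorem fatRectangles_poincare_step_rate {lS : ℕ} {m : ℝ} (hm : 0 < m)
    (hSMT : ∀ L : ℕ, ∀ Q ∈ fatRectangles L, SMT (U.spec β) Q lS m) :
    ∃ L₁ : ℕ, ∀ L' : ℕ, L₁ ≤ L' → ∀ g : ℝ, 0 ≤ g →
      (∀ Q ∈ fatRectangles L', ∀ τ : Site 2 → ℤˣ, PoincareIneq (U.spec β Q τ) Q g) →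
      ∀ L'' : ℕ, 3 * L'' ≤ 4 * L' → ∀ Q ∈ fatRectangles L'', ∀ τ : Site 2 → ℤˣ,
        PoincareIneq (U.spec β Q τ) Q ((1 - 100 / Real.sqrt L') * g) := by
  classical
  obtain ⟨R, hR1, hR⟩ := exists_flipWeight_bounds U β
  have hR0 : 0 < R := by linarith
  set α : ℝ := R ^ 6 * (2 * r + 1 : ℝ) ^ 2 * (2 * r + 1 : ℝ) ^ 2 with hα
  have hα0 : 0 ≤ α := by positivity
  set Cψ : ℝ := 2 ^ 21 * α * Real.exp (3 * m * r) with hCψ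
  have htend := tendsto_const_mul_pow_mul_exp_neg₃ hm 12 Cψ
  obtain ⟨δ₀, hδ₀⟩ : ∃ δ₀ : ℕ, ∀ δ ≥ δ₀, Cψ * ((δ : ℝ) ^ 12 * Real.exp (-(m * (δ : ℝ)))) < 1 :=
    eventually_atTop.1 (htend.eventually (gt_mem_nhds one_pos))
  set D : ℕ := max (max δ₀ 24) (lS + 3 * r + 3) with hD
  refine ⟨D * D, ?_⟩
  intro L' hL' g hg hPI L'' hL'' Q hQ τ
  -- the parameters
  set δ := Nat.sqrt L' with hδ
  have hDδ : D ≤ δ := Nat.le_sqrt.2 hL'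
  have hδ₀δ : δ₀ ≤ δ := le_trans (le_trans (le_max_left _ _) (le_max_left _ _)) hDδ
  have hδ24 : 24 ≤ δ := le_trans (le_trans (le_max_right _ _) (le_max_left _ _)) hDδ
  have hδl : lS + 3 * r + 3 ≤ δ := le_trans (le_max_right _ _) hDδ
  have hδL : δ * δ ≤ L' := Nat.sqrt_le L'
  have hLδ : L' < (δ + 1) * (δ + 1) := Nat.lt_succ_sqrt L'
  set ρ := δ - r with hρ
  have hρr : ρ + r = δ := by omega
  set N := L' / (12 * δ) - 1 with hN
  have hdiv2 : 2 ≤ L' / (12 * δ) := by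
    rw [Nat.le_div_iff_mul_le (by omega)]
    nlinarith
  have hN1 : N + 1 = L' / (12 * δ) := by omega
  have hNpos : 0 < N := by omega
  have hNδ : 12 * (N * δ + δ) ≤ L' := by
    have h1 : L' / (12 * δ) * (12 * δ) ≤ L' := Nat.div_mul_le_self L' (12 * δ)
    rw [← hN1] at h1
    nlinarith
  have hρL : 10 * (ρ + 1) ≤ L' := by
    have : 10 * (δ + 1) ≤ δ * δ := by nlinarith
    omega
  -- the two-block error `κ(L') ≤ 1/(4L')`
  set A : ℝ := α * ((4 * L' ^ 2 : ℕ) : ℝ) * ((2 * (ρ + r) + 1) ^ 2 : ℕ) *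
    Real.exp (-(m * ((ρ : ℝ) - 2 * r))) with hA
  set κ : ℝ := (1 + R ^ 6 * (2 * r + 1 : ℝ) ^ 2 * (2 * r + 1 : ℝ) ^ 2 * ((4 * L' ^ 2 : ℕ) : ℝ) *
    ((2 * (ρ + r) + 1) ^ 2 : ℕ) * Real.exp (-(m * ((ρ : ℝ) - 2 * r)))) ^ (4 * L' ^ 2) - 1 with hκ
  have hκA : κ = (1 + A) ^ (4 * L' ^ 2) - 1 := by rw [hκ, hA, hα]
  have hA0 : 0 ≤ A := by positivity
  have hδ1 : (1 : ℝ) ≤ δ := by exact_mod_cast (show 1 ≤ δ by omega)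
  have hδr : ((ρ : ℕ) : ℝ) = (δ : ℝ) - r := by
    have : r ≤ δ := by omega
    rw [hρ, Nat.cast_sub this]
  have hLδ' : (L' : ℝ) < ((δ : ℝ) + 1) ^ 2 := by
    have : ((L' : ℕ) : ℝ) < (((δ + 1) * (δ + 1) : ℕ) : ℝ) := by exact_mod_cast hLδ
    push_cast at this; nlinarith
  have hL'pos : (0 : ℝ) < L' := by
    have : (1 : ℝ) ≤ δ * δ := by nlinarith
    have h2 : ((δ * δ : ℕ) : ℝ) ≤ L' := by exact_mod_cast hδL
    push_cast at h2; linarith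
  -- `A · M ≤ 64 α e^{3mr} (δ+1)^{10} e^{−mδ}`
  have hexp : Real.exp (-(m * ((ρ : ℝ) - 2 * r))) = Real.exp (3 * m * r) * Real.exp (-(m * δ)) := by
    rw [← Real.exp_add, hδr]; ring_nf
  have hP : (((2 * (ρ + r) + 1) ^ 2 : ℕ) : ℝ) ≤ 4 * ((δ : ℝ) + 1) ^ 2 := by
    rw [hρr]; push_cast; nlinarith
  have hM : (((4 * L' ^ 2 : ℕ) : ℝ)) ≤ 4 * ((δ : ℝ) + 1) ^ 4 := by
    push_cast
    have : (L' : ℝ) ^ 2 ≤ (((δ : ℝ) + 1) ^ 2) ^ 2 := pow_le_pow_left₀ hL'pos.le hLδ'.le 2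
    nlinarith
  have hAM : A * ((4 * L' ^ 2 : ℕ) : ℝ) ≤ 64 * α * Real.exp (3 * m * r) * ((δ : ℝ) + 1) ^ 10 *
      Real.exp (-(m * δ)) := by
    rw [hA, hexp]
    have h1 : α * ((4 * L' ^ 2 : ℕ) : ℝ) * (((2 * (ρ + r) + 1) ^ 2 : ℕ) : ℝ) *
        (Real.exp (3 * m * r) * Real.exp (-(m * δ))) * ((4 * L' ^ 2 : ℕ) : ℝ) =
        α * Real.exp (3 * m * r) * Real.exp (-(m * δ)) *
          ((((4 * L' ^ 2 : ℕ) : ℝ)) * (((4 * L' ^ 2 : ℕ) : ℝ)) * (((2 * (ρ + r) + 1) ^ 2 : ℕ) : ℝ)) := by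
      ring
    rw [h1]
    have h2 : (((4 * L' ^ 2 : ℕ) : ℝ)) * (((4 * L' ^ 2 : ℕ) : ℝ)) * (((2 * (ρ + r) + 1) ^ 2 : ℕ) : ℝ) ≤
        (4 * ((δ : ℝ) + 1) ^ 4) * (4 * ((δ : ℝ) + 1) ^ 4) * (4 * ((δ : ℝ) + 1) ^ 2) := by
      gcongr
    calc α * Real.exp (3 * m * r) * Real.exp (-(m * δ)) *
          ((((4 * L' ^ 2 : ℕ) : ℝ)) * (((4 * L' ^ 2 : ℕ) : ℝ)) * (((2 * (ρ + r) + 1) ^ 2 : ℕ) : ℝ))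
        ≤ α * Real.exp (3 * m * r) * Real.exp (-(m * δ)) *
          ((4 * ((δ : ℝ) + 1) ^ 4) * (4 * ((δ : ℝ) + 1) ^ 4) * (4 * ((δ : ℝ) + 1) ^ 2)) :=
          mul_le_mul_of_nonneg_left h2 (by positivity)
      _ = 64 * α * Real.exp (3 * m * r) * ((δ : ℝ) + 1) ^ 10 * Real.exp (-(m * δ)) := by ring
  -- `(δ+1)^{12} ≤ 2^{12} δ^{12}`, so `8 (δ+1)² · A M ≤ Cψ δ^{12} e^{−mδ} < 1`
  have hsmall := hδ₀ δ hδ₀δ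
  have hδ12 : ((δ : ℝ) + 1) ^ 12 ≤ 2 ^ 12 * (δ : ℝ) ^ 12 := by
    rw [← mul_pow]; exact pow_le_pow_left₀ (by positivity) (by linarith) 12
  have hAM8 : 8 * ((δ : ℝ) + 1) ^ 2 * (A * ((4 * L' ^ 2 : ℕ) : ℝ)) ≤ 1 := by
    have h1 : 8 * ((δ : ℝ) + 1) ^ 2 * (64 * α * Real.exp (3 * m * r) * ((δ : ℝ) + 1) ^ 10 *
        Real.exp (-(m * δ))) = 512 * α * Real.exp (3 * m * r) * ((δ : ℝ) + 1) ^ 12 * Real.exp (-(m * δ)) := by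
      ring
    have h2 : 512 * α * Real.exp (3 * m * r) * ((δ : ℝ) + 1) ^ 12 * Real.exp (-(m * δ)) ≤
        Cψ * ((δ : ℝ) ^ 12 * Real.exp (-(m * (δ : ℝ)))) := by
      rw [hCψ]
      have : 512 * α * Real.exp (3 * m * r) * ((δ : ℝ) + 1) ^ 12 ≤ 512 * α * Real.exp (3 * m * r) *
          (2 ^ 12 * (δ : ℝ) ^ 12) := mul_le_mul_of_nonneg_left hδ12 (by positivity)
      nlinarith [Real.exp_pos (-(m * (δ : ℝ))), this]
    calc 8 * ((δ : ℝ) + 1) ^ 2 * (A * ((4 * L' ^ 2 : ℕ) : ℝ))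
        ≤ 8 * ((δ : ℝ) + 1) ^ 2 * (64 * α * Real.exp (3 * m * r) * ((δ : ℝ) + 1) ^ 10 * Real.exp (-(m * δ))) :=
          mul_le_mul_of_nonneg_left hAM (by positivity)
      _ ≤ 1 := by rw [h1]; exact h2.trans hsmall.le
  have hAM1 : A * ((4 * L' ^ 2 : ℕ) : ℝ) ≤ 1 := by
    have : (1 : ℝ) ≤ 8 * ((δ : ℝ) + 1) ^ 2 := by nlinarith
    nlinarith [mul_nonneg hA0 (by positivity : (0 : ℝ) ≤ ((4 * L' ^ 2 : ℕ) : ℝ))]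
  have hκle : κ ≤ 2 * (A * ((4 * L' ^ 2 : ℕ) : ℝ)) := by
    rw [hκA]
    have h1 : (1 + A) ^ (4 * L' ^ 2) ≤ Real.exp (A * ((4 * L' ^ 2 : ℕ) : ℝ)) := by
      rw [show A * ((4 * L' ^ 2 : ℕ) : ℝ) = ((4 * L' ^ 2 : ℕ) : ℝ) * A by ring, Real.exp_nat_mul]
      exact pow_le_pow_left₀ (by positivity) (by linarith [Real.add_one_le_exp A]) _
    have h2 : |Real.exp (A * ((4 * L' ^ 2 : ℕ) : ℝ)) - 1| ≤ 2 * |A * ((4 * L' ^ 2 : ℕ) : ℝ)| :=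
      Real.abs_exp_sub_one_le (by rw [abs_of_nonneg (by positivity)]; exact hAM1)
    rw [abs_of_nonneg (show (0 : ℝ) ≤ A * ((4 * L' ^ 2 : ℕ) : ℝ) by positivity)] at h2
    have h3 := (abs_le.1 h2).2
    linarith
  have hκL : κ ≤ 1 / (4 * (L' : ℝ)) := by
    have h1 : κ * (8 * ((δ : ℝ) + 1) ^ 2) ≤ 2 := by nlinarith [hκle, hAM8]
    rw [le_div_iff₀ (by positivity)]
    nlinarith [hLδ', h1]
  have hκ0 : 0 ≤ κ := by
    rw [hκA, sub_nonneg]; exact one_le_pow₀ (by linarith)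
  have hκhalf : κ < 1 / 2 := by
    have : 1 / (4 * (L' : ℝ)) ≤ 1 / 4 := by
      apply div_le_div_of_nonneg_left (by norm_num) (by norm_num)
      have : (1 : ℝ) ≤ L' := by exact_mod_cast (show 1 ≤ L' by nlinarith)
      linarith
    linarith
  -- the scale step
  have hstep := fatRectangles_poincare_step U β hR1 hR hm hSMT (L' := L') (δ := δ) (N := N) (ρ := ρ) hNpos
    (by omega) (by omega) (by omega) (by omega) hNδ hρL (κ := κ) (by rw [hκ]) hκhalf hg hPI hL'' Q hQ τ
  refine hstep.mono ?_
  -- `(1 − 100/√L') ≤ θ²`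
  set x : ℝ := 1 / Real.sqrt L' with hx
  have hsqrtL : 0 < Real.sqrt L' := Real.sqrt_pos.2 hL'pos
  have hx0 : 0 ≤ x := by positivity
  have hsqε : Real.sqrt (κ / (1 - κ)) ≤ x := by
    have h1 : κ / (1 - κ) ≤ 2 * κ := by
      rw [div_le_iff₀ (by linarith)]; nlinarith
    have h2 : 2 * κ ≤ 1 / (L' : ℝ) := by
      have := hκL; rw [le_div_iff₀ (by positivity)] at this; rw [le_div_iff₀ hL'pos]; linarith
    calc Real.sqrt (κ / (1 - κ)) ≤ Real.sqrt (1 / (L' : ℝ)) := Real.sqrt_le_sqrt (h1.trans h2)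
      _ = x := by rw [hx, Real.sqrt_div' _ hL'pos.le, Real.sqrt_one]
  -- `1/(N+1) ≤ 48/√L'`
  have hN1r : (Real.sqrt L') / 48 ≤ (N : ℝ) + 1 := by
    have h1 : ((N + 1 : ℕ) : ℝ) = ((L' / (12 * δ) : ℕ) : ℝ) := by rw [hN1]
    have h2 : (L' : ℝ) - 12 * δ < ((L' / (12 * δ) : ℕ) : ℝ) * (12 * δ) := by
      have h3 : L' < (L' / (12 * δ) + 1) * (12 * δ) := by
        have := Nat.lt_div_mul_add (a := L') (b := 12 * δ) (by omega)
        linarith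
      have h4 : ((L' : ℕ) : ℝ) < (((L' / (12 * δ) + 1) * (12 * δ) : ℕ) : ℝ) := by exact_mod_cast h3
      push_cast at h4; linarith
    have hδsq : Real.sqrt L' < (δ : ℝ) + 1 := by
      rw [Real.sqrt_lt' (by positivity)]; exact hLδ'
    have hδle : (δ : ℝ) ≤ Real.sqrt L' := by
      rw [Real.le_sqrt (by positivity) hL'pos.le]
      have : ((δ * δ : ℕ) : ℝ) ≤ L' := by exact_mod_cast hδL
      push_cast at this; nlinarith
    have hδ24' : (24 : ℝ) ≤ δ := by exact_mod_cast hδ24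
    have hδpos : (0 : ℝ) < δ := by linarith
    -- `N + 1 > L'/(12δ) − 1 ≥ δ/12 − 1 ≥ δ/24 ≥ √L'/48`
    have h5 : ((L' / (12 * δ) : ℕ) : ℝ) > (L' : ℝ) / (12 * δ) - 1 := by
      rw [gt_iff_lt, sub_lt_iff_lt_add, div_lt_iff₀ (by positivity)]; linarith
    have h6 : (δ : ℝ) / 12 ≤ (L' : ℝ) / (12 * δ) := by
      rw [div_le_div_iff₀ (by norm_num) (by positivity)]
      have : ((δ * δ : ℕ) : ℝ) ≤ L' := by exact_mod_cast hδL
      push_cast at this; nlinarith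
    have h7 : ((N : ℕ) : ℝ) + 1 = ((N + 1 : ℕ) : ℝ) := by push_cast; ring
    rw [h7, h1]
    linarith
  have hNfrac : 1 - 48 * x ≤ (N : ℝ) / ((N : ℝ) + 1) := by
    have hN1pos : (0 : ℝ) < (N : ℝ) + 1 := by positivity
    rw [le_div_iff₀ hN1pos]
    have : 48 * x * ((N : ℝ) + 1) ≥ 1 := by
      rw [hx]
      have := hN1r
      rw [ge_iff_le, show 48 * (1 / Real.sqrt L') * ((N : ℝ) + 1) = ((N : ℝ) + 1) / (Real.sqrt L' / 48) by
        field_simp]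
      rw [le_div_iff₀ (by positivity)]; linarith
    nlinarith
  -- `θ ≥ (1 − x)(1 − 48x) ≥ 1 − 49x`, `θ² ≥ 1 − 100 x`
  set θ : ℝ := (1 - Real.sqrt (κ / (1 - κ))) * N / (N + 1) with hθ
  have hθfac : θ = (1 - Real.sqrt (κ / (1 - κ))) * ((N : ℝ) / ((N : ℝ) + 1)) := by rw [hθ]; ring
  have h1x : 1 - x ≤ 1 - Real.sqrt (κ / (1 - κ)) := by linarith
  have hθ0 : 0 ≤ θ := by
    rw [hθfac]
    have : 0 ≤ 1 - Real.sqrt (κ / (1 - κ)) := by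
      have : Real.sqrt (κ / (1 - κ)) ≤ 1 := by
        rw [Real.sqrt_le_one, div_le_one (by linarith)]; linarith
      linarith
    positivity
  have hgoal : 1 - 100 / Real.sqrt L' ≤ θ ^ 2 := by
    have e100 : 100 / Real.sqrt L' = 100 * x := by rw [hx]; ring
    rw [e100]
    by_cases ht : 0 ≤ 1 - 49 * x
    · have hθge : 1 - 49 * x ≤ θ := by
        rw [hθfac]
        have hfrac0 : 0 ≤ (N : ℝ) / ((N : ℝ) + 1) := by positivity
        by_cases h48 : 0 ≤ 1 - 48 * x
        · calc 1 - 49 * x ≤ (1 - x) * (1 - 48 * x) := by nlinarith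
            _ ≤ (1 - Real.sqrt (κ / (1 - κ))) * ((N : ℝ) / ((N : ℝ) + 1)) :=
                mul_le_mul h1x hNfrac h48 (by linarith)
        · have : 1 - 49 * x ≤ 0 := by linarith
          linarith [mul_nonneg (show 0 ≤ 1 - Real.sqrt (κ / (1 - κ)) by linarith) hfrac0]
      nlinarith
    · nlinarith
  exact mul_le_mul_of_nonneg_right hgoal hg

end Glauber

end Literature.Probability.LatticeModels

end
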